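import Literature.Algebra.EuclideanLattices.GapCVPCoNPComplete
import Literature.LinearAlgebra.Matrix.IntegerGramCertificate
import HarnessLib

/-!
# Exact PSD certificates of polynomial size: discharge of `FarCert.psd_cert_exists`

Topic `Algebra/EuclideanLattices` (family `pqc`), the proofs file of `GapCVPCoNPComplete.lean`.
Everything here is PROVED; the main results are

* `ExactLDL.eq_gram` — **exact `LDLᵀ` by subdeterminants**: a symmetric positive semidefinite real
  matrix `A` equals `∑ₖ (Dₖ Dₖ₊₁)⁻¹ mₖ mₖᵀ` along a maximal chain of pivots `p₀, p₁, …`, where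
  `Dₖ = det A[p_{<k}; p_{<k}]` are the principal minors of the chain and
  `mₖ(y) = det A[p_{<k}, pₖ ; p_{<k}, y]` the bordered minors — the rows of fraction-free Gaussian
  elimination, i.e. the numbers met in Gaussian elimination written as quotients of subdeterminants
  of the input (Schrijver 1986, §3.3, Thm. 3.3 and its proof; Edmonds 1967);
* `ExactLDL.exists_integer_gram_cert` — for a symmetric integer `Q`, positive semidefinite over `ℝ`,
  with `|Q i k| ≤ T`: integers `σ ≥ 1`, `R ∈ ℤ^{m×n}`, `m ≤ 4n`, with `σ² Q = RᵀR`, `σ ≤ H^{2n}`,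
  `|R i k| ≤ H^{2n+1}`, `H = n! (max T 1)ⁿ` (Hadamard-type bound on all minors); here
  `σ = ∏ₖ Dₖ Dₖ₊₁` and the rows of `R` are `(σ / DₖDₖ₊₁) aₖₛ mₖ` with `DₖDₖ₊₁ = ∑_{s<4} aₖₛ²`
  (Lagrange);
* `FarCert.psd_cert_exists_holds : FarCert.psd_cert_exists` — the named fact of
  `GapCVPCoNPComplete.lean`, with the size polynomial `psdCertPoly = (2X+1)(X² + X(X+1) + 2) + 1` in
  `X = n + S`.

Proof architecture (no Gaussian elimination is run; everything is stated through determinants).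
A chain is a list `L` of distinct indices, most recent pivot first; `pminor A L = det A[L; L]`,
`bord A L i j = det A[i, L; j, L]`, and `cvec A L i` is the cofactor vector of that bordered minor
along its first column, so that `bord A L i = cvec A L i ᵥ* A` (Laplace, `bord_eq_sum`), `bord A L i`
vanishes on `L` (repeated column) and `cvec A L i` is supported on `i :: L` with value `pminor A L`
at `i`. The chain is GOOD when all its suffix minors are nonzero; `gram A L` is the partial sum
`∑ (Dₖ Dₖ₊₁)⁻¹ mₖ mₖᵀ`. By induction on the chain: `gram A L` kills every `v` with `A v = 0` on `L`
(`gram_mulVec_eq_zero`); the residual `A − gram A L` vanishes on the columns of the chain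
(`sub_gram_apply_eq_zero`); hence the Bareiss–Schrijver relation
`det A[j, L; y, L] = det A[L; L] · (A − gram A L) y j` (`bord_eq_pminor_mul`); hence the residual stays
positive semidefinite (one Cauchy–Schwarz step, `dotProduct_sub_gram_mulVec_nonneg`) and
`Dₖ Dₖ₊₁ = cvecᵀ A cvec > 0`. For a chain that cannot be extended (`exists_maximal_good`, a longest
good chain) every bordered principal minor vanishes, so the residual has zero diagonal and, being
positive semidefinite, is zero (`eq_zero_of_diag_eq_zero`). Sizes: every number is a minor of `Q`,
at most `H`; `σ ≤ H^{2n}`; entries of `R` at most `σ H`.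

## References

* A. Schrijver, *Theory of Linear and Integer Programming*, Wiley 1986, §3.3 (Thm. 3.3: the Gaussian
  elimination method is polynomial-time — each number arising is a quotient of two subdeterminants
  of the original matrix; Cor. 3.3a).
* J. Edmonds, *Systems of distinct representatives and linear algebra*, J. Res. NBS 71B (1967)
  241–245 (the subdeterminant form of the elimination entries) — background, cited through Schrijver.
* D. Aharonov, O. Regev, *Lattice problems in NP ∩ coNP*, J. ACM 52 (2005), §6 (the use: exact
  certificates for the verifier's positive-semidefiniteness test).
-/

noncomputable section

open Matrix Finset

namespace Literature.Algebra.EuclideanLattices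

namespace ExactLDL

variable {R : Type*} [CommRing R] {n : ℕ}

/-- Positions of a list of indices, most recent pivot first: `emb (i :: L) = Fin.cons i (emb L)`.
[folklore] -/
def emb : (L : List (Fin n)) → (Fin L.length → Fin n)
  | [] => Fin.elim0
  | i :: L => Fin.cons i (emb L)

/-- The principal minor on the indices of `L`. [folklore] -/
def pminor (A : Matrix (Fin n) (Fin n) R) (L : List (Fin n)) : R :=
  (A.submatrix (emb L) (emb L)).det

/-- The bordered minor: rows `i, L`, columns `j, L`. [folklore] -/
def bord (A : Matrix (Fin n) (Fin n) R) (L : List (Fin n)) (i j : Fin n) : R :=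
  (A.submatrix (Fin.cons i (emb L) : Fin (L.length + 1) → Fin n) (Fin.cons j (emb L) : Fin (L.length + 1) → Fin n)).det

/-- The cofactor vector of the bordered minor along its first column. [folklore] -/
def cvec (A : Matrix (Fin n) (Fin n) R) (L : List (Fin n)) (i : Fin n) (x : Fin n) : R :=
  ∑ t : Fin (L.length + 1), if (Fin.cons i (emb L) : Fin (L.length + 1) → Fin n) t = x then
    (-1) ^ (t : ℕ) * (A.submatrix ((Fin.cons i (emb L) : Fin (L.length + 1) → Fin n) ∘ t.succAbove) (emb L)).det else 0

/-- `emb` of a cons. [folklore] -/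
theorem emb_cons (i : Fin n) (L : List (Fin n)) : emb (i :: L) = Fin.cons i (emb L) := rfl

/-- The empty principal minor is `1`. [folklore] -/
theorem pminor_nil (A : Matrix (Fin n) (Fin n) R) : pminor A [] = 1 := by
  simp [pminor]

/-- `D(i :: L)` is the bordered minor `det A[i, L; i, L]`. [folklore] -/
theorem pminor_cons (A : Matrix (Fin n) (Fin n) R) (i : Fin n) (L : List (Fin n)) :
    pminor A (i :: L) = bord A L i i := rfl

/-- Positions of `L` are members of `L`. [folklore] -/
theorem emb_mem : ∀ (L : List (Fin n)) (t : Fin L.length), emb L t ∈ L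
  | [], t => t.elim0
  | i :: L, t => by
    refine Fin.cases ?_ (fun s => ?_) t
    · simp [emb]
    · simp only [emb, Fin.cons_succ]; exact List.mem_cons_of_mem _ (emb_mem L s)

/-- Members of `L` are positions of `L`. [folklore] -/
theorem exists_emb_eq_of_mem : ∀ {L : List (Fin n)} {x : Fin n}, x ∈ L → ∃ t : Fin L.length, emb L t = x
  | [], x, h => by simp at h
  | i :: L, x, h => by
    rcases List.mem_cons.1 h with rfl | h
    · exact ⟨(0 : Fin (L.length + 1)), by simp [emb]⟩
    · obtain ⟨t, ht⟩ := exists_emb_eq_of_mem h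
      exact ⟨t.succ, by simp [emb, ht]⟩

/-- Laplace expansion of the bordered minor along its first column: `det A[i, L; j, L] = ∑ₓ c(x) A x j`.
[folklore] -/
theorem bord_eq_sum (A : Matrix (Fin n) (Fin n) R) (L : List (Fin n)) (i j : Fin n) :
    bord A L i j = ∑ x, cvec A L i x * A x j := by
  unfold bord cvec
  rw [det_succ_column_zero]
  simp_rw [Finset.sum_mul]
  rw [Finset.sum_comm]
  refine Finset.sum_congr rfl fun t _ => ?_
  simp only [ite_mul, zero_mul, Finset.sum_ite_eq, Finset.mem_univ, if_true]
  simp only [submatrix_apply, Fin.cons_zero, submatrix_submatrix]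
  have : (Fin.cons j (emb L) : Fin (L.length + 1) → Fin n) ∘ Fin.succ = emb L := funext fun s => by simp
  rw [this]
  ring

/-- The bordered minors as a row vector: `m = c ᵥ* A`. [folklore] -/
theorem bord_eq_vecMul (A : Matrix (Fin n) (Fin n) R) (L : List (Fin n)) (i : Fin n) :
    bord A L i = cvec A L i ᵥ* A := by
  funext j
  rw [bord_eq_sum]
  rfl

/-- For symmetric `A`: `m = A *ᵥ c`. [folklore] -/
theorem bord_eq_mulVec {A : Matrix (Fin n) (Fin n) R} (hA : Aᵀ = A) (L : List (Fin n)) (i : Fin n) :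
    bord A L i = A *ᵥ cvec A L i := by
  rw [bord_eq_vecMul, ← vecMul_transpose, hA]

/-- The bordered minor vanishes on the chain (a repeated column). [folklore] -/
theorem bord_eq_zero_of_mem (A : Matrix (Fin n) (Fin n) R) {L : List (Fin n)} (i : Fin n) {x : Fin n} (hx : x ∈ L) :
    bord A L i x = 0 := by
  obtain ⟨s, hs⟩ := exists_emb_eq_of_mem hx
  unfold bord
  refine det_zero_of_column_eq (Fin.succ_ne_zero s).symm fun k => ?_
  simp [hs]

/-- The cofactor vector is supported on `i :: L`. [folklore] -/
theorem cvec_eq_zero (A : Matrix (Fin n) (Fin n) R) {L : List (Fin n)} {i x : Fin n} (hxi : x ≠ i) (hx : x ∉ L) :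
    cvec A L i x = 0 := by
  unfold cvec
  refine Finset.sum_eq_zero fun t _ => ?_
  rw [if_neg]
  refine Fin.cases ?_ (fun s => ?_) t
  · simpa using hxi.symm
  · simp only [Fin.cons_succ]
    exact fun h => hx (h ▸ emb_mem L s)

/-- The cofactor of the corner entry is the principal minor `det A[L; L]`. [folklore] -/
theorem cvec_self (A : Matrix (Fin n) (Fin n) R) {L : List (Fin n)} {i : Fin n} (hi : i ∉ L) :
    cvec A L i i = pminor A L := by
  unfold cvec pminor
  rw [Finset.sum_eq_single (0 : Fin (L.length + 1))]
  · simp only [Fin.cons_zero, if_true, Fin.val_zero, pow_zero, one_mul, Fin.succAbove_zero]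
    rfl
  · intro t _ ht
    obtain ⟨s, rfl⟩ := Fin.exists_succ_eq.2 ht
    rw [if_neg]
    simp only [Fin.cons_succ]
    exact fun h => hi (h ▸ emb_mem L s)
  · simp

/-- `c ⬝ m = D(L) · D(i :: L)`. [folklore] -/
theorem cvec_dotProduct_bord (A : Matrix (Fin n) (Fin n) R) {L : List (Fin n)} {i : Fin n} (hi : i ∉ L) :
    cvec A L i ⬝ᵥ bord A L i = pminor A L * bord A L i i := by
  unfold dotProduct
  rw [Finset.sum_eq_single i]
  · rw [cvec_self A hi]
  · intro x _ hxi
    by_cases hx : x ∈ L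
    · rw [bord_eq_zero_of_mem A i hx, mul_zero]
    · rw [cvec_eq_zero A hxi hx, zero_mul]
  · simp


/-- `vecMulVec u v *ᵥ w = (v ⬝ᵥ w) • u` over a commutative ring. [folklore] -/
theorem vecMulVec_mulVec_comm (u v w : Fin n → R) : vecMulVec u v *ᵥ w = (v ⬝ᵥ w) • u := by
  ext y
  simp only [mulVec, dotProduct, vecMulVec_apply, Pi.smul_apply, smul_eq_mul]
  rw [Finset.sum_mul]
  exact Finset.sum_congr rfl fun x _ => by ring

section Field

variable {F : Type*} [Field F]

/-- A good chain of pivots: every suffix has a nonzero principal minor. [folklore] -/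
def Good (A : Matrix (Fin n) (Fin n) F) : List (Fin n) → Prop
  | [] => True
  | i :: L => Good A L ∧ pminor A (i :: L) ≠ 0

/-- A good chain has a nonzero principal minor. [folklore] -/
theorem Good.pminor_ne_zero {A : Matrix (Fin n) (Fin n) F} : ∀ {L : List (Fin n)}, Good A L → pminor A L ≠ 0
  | [], _ => by rw [pminor_nil]; exact one_ne_zero
  | _ :: _, h => h.2

/-- The partial Gram sum `∑ₖ (D_{k} D_{k+1})⁻¹ mₖ mₖᵀ` of the fraction-free elimination rows along the
chain `L` (most recent pivot first). [folklore] -/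
def gram (A : Matrix (Fin n) (Fin n) F) : List (Fin n) → Matrix (Fin n) (Fin n) F
  | [] => 0
  | i :: L => gram A L + (pminor A L * bord A L i i)⁻¹ • vecMulVec (bord A L i) (bord A L i)

/-- `gram` of the empty chain. [folklore] -/
theorem gram_nil (A : Matrix (Fin n) (Fin n) F) : gram A [] = 0 := rfl

/-- `gram` of a cons: one more rank-one term. [folklore] -/
theorem gram_cons (A : Matrix (Fin n) (Fin n) F) (i : Fin n) (L : List (Fin n)) :
    gram A (i :: L) = gram A L + (pminor A L * bord A L i i)⁻¹ • vecMulVec (bord A L i) (bord A L i) := rfl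

/-- The partial Gram sum is symmetric. [folklore] -/
theorem gram_transpose (A : Matrix (Fin n) (Fin n) F) : ∀ L : List (Fin n), (gram A L)ᵀ = gram A L
  | [] => by simp [gram_nil]
  | i :: L => by rw [gram_cons, transpose_add, transpose_smul, transpose_vecMulVec, gram_transpose A L]

/-- The partial Gram sum kills every vector whose image under `A` vanishes on the chain. [folklore] -/
theorem gram_mulVec_eq_zero (A : Matrix (Fin n) (Fin n) F) :
    ∀ (L : List (Fin n)) (v : Fin n → F), (∀ x ∈ L, (A *ᵥ v) x = 0) → gram A L *ᵥ v = 0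
  | [], v, _ => by simp [gram_nil]
  | i :: L, v, hv => by
    have ih := gram_mulVec_eq_zero A L v (fun x hx => hv x (List.mem_cons_of_mem _ hx))
    have h0 : bord A L i ⬝ᵥ v = 0 := by
      rw [bord_eq_vecMul, ← dotProduct_mulVec]
      refine Finset.sum_eq_zero fun x _ => ?_
      by_cases hx : x ∈ i :: L
      · rw [hv x hx, mul_zero]
      · rw [cvec_eq_zero A (fun h => hx (List.mem_cons.2 (Or.inl h))) (fun h => hx (List.mem_cons_of_mem _ h)), zero_mul]
    rw [gram_cons, add_mulVec, smul_mulVec, ih, zero_add, vecMulVec_mulVec_comm, h0, zero_smul, smul_zero]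

/-- Columns of the residual `A − gram A L` indexed by the chain vanish (for symmetric `A`, a good chain
of distinct indices). [folklore] -/
theorem sub_gram_apply_eq_zero {A : Matrix (Fin n) (Fin n) F} (hA : Aᵀ = A) :
    ∀ {L : List (Fin n)}, L.Nodup → Good A L → ∀ x ∈ L, ∀ y, (A - gram A L) y x = 0
  | [], _, _, x, hx, _ => by simp at hx
  | i :: L, hnd, hg, x, hx, y => by
    obtain ⟨hiL, hndL⟩ := List.nodup_cons.1 hnd
    obtain ⟨hgL, hD⟩ := hg
    have ih := sub_gram_apply_eq_zero hA hndL hgL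
    have hD' : pminor A L ≠ 0 := hgL.pminor_ne_zero
    rw [pminor_cons] at hD
    have hcolL : ∀ x ∈ L, ∀ y, (A - gram A (i :: L)) y x = 0 := fun x hx y => by
      have := ih x hx y
      rw [Matrix.sub_apply] at this
      rw [gram_cons, Matrix.sub_apply, Matrix.add_apply, Matrix.smul_apply, vecMulVec_apply, bord_eq_zero_of_mem A i hx,
        mul_zero, smul_zero, add_zero, this]
    rcases List.mem_cons.1 hx with rfl | hxL
    · have hE : (A - gram A (x :: L)) *ᵥ cvec A L x = 0 := by
        rw [sub_mulVec, ← bord_eq_mulVec hA, gram_cons, add_mulVec, smul_mulVec,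
          gram_mulVec_eq_zero A L _ (fun z hz => by rw [← bord_eq_mulVec hA]; exact bord_eq_zero_of_mem A x hz),
          zero_add, vecMulVec_mulVec_comm, dotProduct_comm, cvec_dotProduct_bord A hiL, smul_smul,
          inv_mul_cancel₀ (mul_ne_zero hD' hD), one_smul, sub_self]
      have key : ((A - gram A (x :: L)) *ᵥ cvec A L x) y = (A - gram A (x :: L)) y x * pminor A L := by
        simp only [mulVec, dotProduct]
        rw [Finset.sum_eq_single x]
        · rw [cvec_self A hiL]
        · intro z _ hzx
          by_cases hz : z ∈ L
          · rw [hcolL z hz y, zero_mul]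
          · rw [cvec_eq_zero A hzx hz, mul_zero]
        · simp
      have h0 := congrFun hE y
      rw [key, Pi.zero_apply, mul_eq_zero] at h0
      exact h0.resolve_right hD'
    · exact hcolL x hxL y

/-- **The subdeterminant form of the elimination entries** (Schrijver 1986, proof of Thm. 3.3;
Edmonds 1967): along a good chain the bordered minors are the principal minor times the residual
column, `det A[j, L; y, L] = det A[L; L] · (A − gram A L) y j` — i.e. the entries of the Schur
complement after eliminating the chain are quotients of two subdeterminants of `A`.
[cite: Schrijver1986, §3.3, Thm. 3.3 (proof)] -/
theorem bord_eq_pminor_mul {A : Matrix (Fin n) (Fin n) F} (hA : Aᵀ = A) {L : List (Fin n)} (hnd : L.Nodup)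
    (hg : Good A L) {j : Fin n} (hj : j ∉ L) (y : Fin n) :
    bord A L j y = pminor A L * (A - gram A L) y j := by
  have h1 : bord A L j = (A - gram A L) *ᵥ cvec A L j := by
    rw [sub_mulVec, ← bord_eq_mulVec hA,
      gram_mulVec_eq_zero A L _ (fun z hz => by rw [← bord_eq_mulVec hA]; exact bord_eq_zero_of_mem A j hz), sub_zero]
  rw [h1]
  simp only [mulVec, dotProduct]
  rw [Finset.sum_eq_single j]
  · rw [cvec_self A hj, mul_comm]
  · intro z _ hzj
    by_cases hz : z ∈ L
    · rw [sub_gram_apply_eq_zero hA hnd hg z hz y, zero_mul]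
    · rw [cvec_eq_zero A hzj hz, mul_zero]
  · simp

/-- A good chain of distinct indices that no fresh index extends (a longest good chain). [folklore] -/
theorem exists_maximal_good (A : Matrix (Fin n) (Fin n) F) :
    ∃ L : List (Fin n), L.Nodup ∧ Good A L ∧ ∀ j ∉ L, pminor A (j :: L) = 0 := by
  classical
  let P : ℕ → Prop := fun k => ∃ L : List (Fin n), L.Nodup ∧ Good A L ∧ L.length = k
  have hP0 : P 0 := ⟨[], List.nodup_nil, trivial, rfl⟩
  obtain ⟨L, hnd, hg, hlen⟩ : P (Nat.findGreatest P n) := Nat.findGreatest_spec (Nat.zero_le n) hP0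
  refine ⟨L, hnd, hg, fun j hj => ?_⟩
  by_contra hne
  have hnd' : (j :: L).Nodup := List.nodup_cons.2 ⟨hj, hnd⟩
  have hP : P (Nat.findGreatest P n + 1) := ⟨j :: L, hnd', ⟨hg, hne⟩, by rw [List.length_cons, hlen]⟩
  have hle : Nat.findGreatest P n + 1 ≤ n := by
    have := hnd'.length_le_card
    rw [Fintype.card_fin, List.length_cons, hlen] at this
    exact this
  have := Nat.le_findGreatest hle hP
  omega

end Field

section Real

/-- Cauchy–Schwarz for a symmetric positive semidefinite real matrix against a coordinate vector:
`((E u) i)² ≤ (uᵀ E u) · E i i` (here for `E i i > 0`). [folklore] -/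
theorem sq_mulVec_apply_le {E : Matrix (Fin n) (Fin n) ℝ} (hE : Eᵀ = E) (hpsd : ∀ u, 0 ≤ u ⬝ᵥ (E *ᵥ u))
    (u : Fin n → ℝ) (i : Fin n) (hi : 0 < E i i) :
    ((E *ᵥ u) i) ^ 2 ≤ (u ⬝ᵥ (E *ᵥ u)) * E i i := by
  have h1 : u ⬝ᵥ (E *ᵥ Pi.single i 1) = (E *ᵥ u) i := by
    rw [dotProduct_mulVec, ← mulVec_transpose, hE, dotProduct_single, mul_one]
  have h2 : Pi.single i 1 ⬝ᵥ (E *ᵥ u) = (E *ᵥ u) i := by rw [single_dotProduct, one_mul]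
  have h3 : Pi.single i (1 : ℝ) ⬝ᵥ (E *ᵥ Pi.single i 1) = E i i := by
    rw [mulVec_single_one, single_dotProduct, one_mul, col_apply]
  have h := hpsd (E i i • u - (E *ᵥ u) i • Pi.single i 1)
  rw [mulVec_sub, mulVec_smul, mulVec_smul, dotProduct_sub, sub_dotProduct, sub_dotProduct, dotProduct_smul,
    dotProduct_smul, dotProduct_smul, dotProduct_smul, smul_dotProduct, smul_dotProduct, smul_dotProduct,
    smul_dotProduct, h1, h2, h3] at h
  simp only [smul_eq_mul] at h
  nlinarith [h, hi]

/-- The residuals `A − gram A L` along a good chain of a symmetric positive semidefinite real matrix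
stay positive semidefinite (induction on the chain, one Cauchy–Schwarz step each). [folklore] -/
theorem dotProduct_sub_gram_mulVec_nonneg {A : Matrix (Fin n) (Fin n) ℝ} (hA : Aᵀ = A) (hpsd : ∀ u, 0 ≤ u ⬝ᵥ (A *ᵥ u)) :
    ∀ {L : List (Fin n)}, L.Nodup → Good A L → ∀ u, 0 ≤ u ⬝ᵥ ((A - gram A L) *ᵥ u)
  | [], _, _, u => by simpa [gram_nil] using hpsd u
  | i :: L, hnd, hg, u => by
    obtain ⟨hiL, hndL⟩ := List.nodup_cons.1 hnd
    obtain ⟨hgL, hD⟩ := hg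
    have ih : ∀ u, 0 ≤ u ⬝ᵥ ((A - gram A L) *ᵥ u) := fun u => dotProduct_sub_gram_mulVec_nonneg hA hpsd hndL hgL u
    have hEt : (A - gram A L)ᵀ = A - gram A L := by rw [transpose_sub, hA, gram_transpose]
    have hK : ∀ y, bord A L i y = pminor A L * (A - gram A L) y i := bord_eq_pminor_mul hA hndL hgL hiL
    have hD' : pminor A L ≠ 0 := hgL.pminor_ne_zero
    rw [pminor_cons] at hD
    have he : (A - gram A L) i i ≠ 0 := fun h => hD (by rw [hK i, h, mul_zero])
    have he0 : 0 < (A - gram A L) i i := by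
      refine lt_of_le_of_ne ?_ (Ne.symm he)
      have := ih (Pi.single i 1)
      rwa [mulVec_single_one, single_dotProduct, one_mul, col_apply] at this
    have hsym : ∀ y, (A - gram A L) y i = (A - gram A L) i y := fun y => by
      have := congrFun (congrFun hEt i) y; rwa [transpose_apply] at this
    have hm : bord A L i ⬝ᵥ u = pminor A L * ((A - gram A L) *ᵥ u) i := by
      simp only [dotProduct, mulVec, Finset.mul_sum]
      exact Finset.sum_congr rfl fun y _ => by rw [hK y, hsym y]; ring
    have hgoal : u ⬝ᵥ ((A - gram A (i :: L)) *ᵥ u) =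
        u ⬝ᵥ ((A - gram A L) *ᵥ u) - (pminor A L * bord A L i i)⁻¹ * (bord A L i ⬝ᵥ u) ^ 2 := by
      rw [gram_cons, ← sub_sub, sub_mulVec _ (_ • _), dotProduct_sub, smul_mulVec, dotProduct_smul,
        vecMulVec_mulVec_comm, dotProduct_smul, smul_eq_mul, smul_eq_mul, sq, dotProduct_comm u (bord A L i)]
    rw [hgoal, hm, hK i]
    have hCS := sq_mulVec_apply_le hEt ih u i he0
    have e1 : (pminor A L * (pminor A L * (A - gram A L) i i))⁻¹ * (pminor A L * ((A - gram A L) *ᵥ u) i) ^ 2 =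
        (((A - gram A L) *ᵥ u) i) ^ 2 / (A - gram A L) i i := by
      field_simp
    rw [e1, sub_nonneg, div_le_iff₀ he0]
    exact hCS

/-- A symmetric positive semidefinite real matrix with zero diagonal vanishes. [folklore] -/
theorem eq_zero_of_diag_eq_zero {E : Matrix (Fin n) (Fin n) ℝ} (hE : Eᵀ = E) (hpsd : ∀ u, 0 ≤ u ⬝ᵥ (E *ᵥ u))
    (hdiag : ∀ i, E i i = 0) : E = 0 := by
  ext i j
  have hsym : E j i = E i j := by
    have := congrFun (congrFun hE i) j; rwa [transpose_apply] at this
  have h := hpsd (Pi.single i 1 - E i j • Pi.single j 1)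
  rw [mulVec_sub, mulVec_smul, dotProduct_sub, sub_dotProduct, sub_dotProduct, dotProduct_smul, dotProduct_smul,
    smul_dotProduct, smul_dotProduct, mulVec_single_one, mulVec_single_one, single_dotProduct, single_dotProduct,
    single_dotProduct, single_dotProduct, col_apply, col_apply, col_apply, col_apply, hdiag i, hdiag j, hsym] at h
  simp only [smul_eq_mul] at h
  rw [Matrix.zero_apply]
  nlinarith [h, sq_nonneg (E i j)]

/-- **Exact `LDLᵀ` along a maximal good chain**: a symmetric positive semidefinite real matrix is
the Gram sum of its fraction-free elimination rows, `A = ∑ₖ (Dₖ Dₖ₊₁)⁻¹ mₖ mₖᵀ` (pivots `Dₖ₊₁/Dₖ`,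
rows `mₖ/Dₖ` — quotients of subdeterminants, Schrijver 1986, Thm. 3.3; the residual of a
non-extendable chain is positive semidefinite with zero diagonal, hence zero).
[cite: Schrijver1986, §3.3, Thm. 3.3 (proof) — exact elimination by subdeterminants] -/
theorem eq_gram {A : Matrix (Fin n) (Fin n) ℝ} (hA : Aᵀ = A) (hpsd : ∀ u, 0 ≤ u ⬝ᵥ (A *ᵥ u)) {L : List (Fin n)}
    (hnd : L.Nodup) (hg : Good A L) (hmax : ∀ j ∉ L, pminor A (j :: L) = 0) : A = gram A L := by
  have hEt : (A - gram A L)ᵀ = A - gram A L := by rw [transpose_sub, hA, gram_transpose]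
  have h0 : A - gram A L = 0 := by
    refine eq_zero_of_diag_eq_zero hEt (dotProduct_sub_gram_mulVec_nonneg hA hpsd hnd hg) fun j => ?_
    by_cases hj : j ∈ L
    · exact sub_gram_apply_eq_zero hA hnd hg j hj j
    · have h1 := bord_eq_pminor_mul hA hnd hg hj j
      rw [← pminor_cons, hmax j hj] at h1
      exact (mul_eq_zero.1 h1.symm).resolve_left hg.pminor_ne_zero
  exact sub_eq_zero.1 h0

/-- Along a good chain of a symmetric positive semidefinite matrix the products `Dₖ Dₖ₊₁ = cᵀ A c` are
positive. [folklore] -/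
theorem pminor_mul_bord_pos {A : Matrix (Fin n) (Fin n) ℝ} (hA : Aᵀ = A) (hpsd : ∀ u, 0 ≤ u ⬝ᵥ (A *ᵥ u))
    {L : List (Fin n)} {i : Fin n} (hiL : i ∉ L) (hg : Good A (i :: L)) : 0 < pminor A L * bord A L i i := by
  have hne : pminor A L * bord A L i i ≠ 0 := mul_ne_zero hg.1.pminor_ne_zero (by rw [← pminor_cons]; exact hg.2)
  refine lt_of_le_of_ne ?_ hne.symm
  rw [← cvec_dotProduct_bord A hiL, bord_eq_mulVec hA]
  exact hpsd _

end Real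


/-! ### Stage accessors along a chain -/

/-- The chain below position `k` (the pivots before the `k`-th most recent one). [folklore] -/
def sfx : (L : List (Fin n)) → Fin L.length → List (Fin n)
  | [], k => k.elim0
  | _ :: L, k => Fin.cases L (fun k' => sfx L k') k

/-- The pivot at position `k`. [folklore] -/
def piv : (L : List (Fin n)) → Fin L.length → Fin n
  | [], k => k.elim0
  | i :: L, k => Fin.cases i (fun k' => piv L k') k

/-- Stage accessors on a cons, position `0`. [folklore] -/
theorem sfx_cons_zero (i : Fin n) (L : List (Fin n)) : sfx (i :: L) (0 : Fin (L.length + 1)) = L := rfl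
/-- Stage accessors on a cons, later positions. [folklore] -/
theorem sfx_cons_succ (i : Fin n) (L : List (Fin n)) (k : Fin L.length) : sfx (i :: L) k.succ = sfx L k := rfl
/-- Pivot accessor on a cons, position `0`. [folklore] -/
theorem piv_cons_zero (i : Fin n) (L : List (Fin n)) : piv (i :: L) (0 : Fin (L.length + 1)) = i := rfl
/-- Pivot accessor on a cons, later positions. [folklore] -/
theorem piv_cons_succ (i : Fin n) (L : List (Fin n)) (k : Fin L.length) : piv (i :: L) k.succ = piv L k := rfl

/-- The chain below a position is shorter than the chain. [folklore] -/
theorem length_sfx_lt : ∀ (L : List (Fin n)) (k : Fin L.length), (sfx L k).length < L.length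
  | [], k => k.elim0
  | i :: L, k => by
    refine Fin.cases ?_ (fun k' => ?_) k
    · rw [sfx_cons_zero, List.length_cons]; exact Nat.lt_succ_self _
    · rw [sfx_cons_succ, List.length_cons]; exact (length_sfx_lt L k').trans (Nat.lt_succ_self _)

section Field

variable {F : Type*} [Field F]

/-- Each stage of a good chain of distinct indices is a good cons with a fresh pivot. [folklore] -/
theorem stage_spec {A : Matrix (Fin n) (Fin n) F} : ∀ {L : List (Fin n)}, L.Nodup → Good A L →
    ∀ k : Fin L.length, piv L k ∉ sfx L k ∧ (sfx L k).Nodup ∧ Good A (piv L k :: sfx L k)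
  | [], _, _, k => k.elim0
  | i :: L, hnd, hg, k => by
    obtain ⟨hiL, hndL⟩ := List.nodup_cons.1 hnd
    refine Fin.cases ?_ (fun k' => ?_) k
    · rw [sfx_cons_zero, piv_cons_zero]; exact ⟨hiL, hndL, hg⟩
    · rw [sfx_cons_succ, piv_cons_succ]; exact stage_spec hndL hg.1 k'

/-- Entries of the partial Gram sum, stage by stage: `(gram A L) x y = ∑ₖ (Dₖ Dₖ₊₁)⁻¹ mₖ(x) mₖ(y)`. [folklore] -/
theorem gram_apply (A : Matrix (Fin n) (Fin n) F) : ∀ (L : List (Fin n)) (x y : Fin n), gram A L x y =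
    ∑ k : Fin L.length, (pminor A (sfx L k) * bord A (sfx L k) (piv L k) (piv L k))⁻¹ *
      (bord A (sfx L k) (piv L k) x * bord A (sfx L k) (piv L k) y)
  | [], x, y => by simp [gram_nil]
  | i :: L, x, y => by
    have h := Fin.sum_univ_succ (fun k : Fin (L.length + 1) =>
      (pminor A (sfx (i :: L) k) * bord A (sfx (i :: L) k) (piv (i :: L) k) (piv (i :: L) k))⁻¹ *
        (bord A (sfx (i :: L) k) (piv (i :: L) k) x * bord A (sfx (i :: L) k) (piv (i :: L) k) y))
    refine Eq.trans ?_ h.symm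
    rw [gram_cons, Matrix.add_apply, Matrix.smul_apply, vecMulVec_apply, smul_eq_mul, gram_apply A L x y, add_comm]
    rfl

end Field

/-! ### Casts from `ℤ` -/

/-- Principal minors commute with the cast `ℤ → ℝ`. [folklore] -/
theorem cast_pminor (Q : Matrix (Fin n) (Fin n) ℤ) (L : List (Fin n)) :
    ((pminor Q L : ℤ) : ℝ) = pminor (Q.map (Int.cast : ℤ → ℝ)) L := by
  unfold pminor; rw [Int.cast_det]; rfl

/-- Bordered minors commute with the cast `ℤ → ℝ`. [folklore] -/
theorem cast_bord (Q : Matrix (Fin n) (Fin n) ℤ) (L : List (Fin n)) (i j : Fin n) :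
    ((bord Q L i j : ℤ) : ℝ) = bord (Q.map (Int.cast : ℤ → ℝ)) L i j := by
  unfold bord; rw [Int.cast_det]; rfl

/-! ### Sizes of minors -/

/-- Hadamard-type bound for all minors: `|det Q[r; c]| ≤ n! (max T 1)ⁿ` for a `k × k` submatrix,
`k ≤ n`, of an integer matrix with entries `≤ T`. [folklore] -/
theorem natAbs_det_submatrix_le {k : ℕ} (Q : Matrix (Fin n) (Fin n) ℤ) {T : ℕ} (hT : ∀ i j, (Q i j).natAbs ≤ T) (hk : k ≤ n)
    (r c : Fin k → Fin n) : (Q.submatrix r c).det.natAbs ≤ n.factorial * (max T 1) ^ n := by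
  have h1 := FarCert.natAbs_det_le_of_entries (Q.submatrix r c) (M := T) fun i j => hT _ _
  refine h1.trans ?_
  have hpos : 0 < max T 1 := lt_of_lt_of_le Nat.one_pos (le_max_right _ _)
  exact Nat.mul_le_mul (Nat.factorial_le hk) ((Nat.pow_le_pow_left (le_max_left _ _) _).trans
    (Nat.pow_le_pow_right hpos hk))

/-! ### The integer certificate -/

/-- **Exact integer Gram certificates for positive semidefinite integer matrices** (the exact-linear-
algebra content of Schrijver 1986, Thm. 3.3 / Cor. 3.3a — every number is a quotient of
subdeterminants, hence of polynomially bounded size — combined with Lagrange's four-square theorem):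
for a symmetric `Q ∈ ℤⁿˣⁿ`, positive semidefinite over `ℝ`, with `|Q i k| ≤ T`, there are
`R ∈ ℤ^{m × n}`, `m ≤ 4n`, and `σ ≥ 1` with `σ² Q = RᵀR`, `σ ≤ H^{2n}` and `|R i k| ≤ H^{2n} · H`, where
`H = n! (max T 1)ⁿ` bounds every minor of `Q`: `σ = ∏ₖ DₖDₖ₊₁`, rows `(σ/DₖDₖ₊₁) aₖₛ mₖ` with
`DₖDₖ₊₁ = ∑_{s<4} aₖₛ²`.
[cite: Schrijver1986, §3.3, Thm. 3.3 and Cor. 3.3a — corollary with Lagrange's four squares] -/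
theorem exists_integer_gram_cert (Q : Matrix (Fin n) (Fin n) ℤ) (hQ : Qᵀ = Q)
    (hpsd : ∀ u : Fin n → ℝ, 0 ≤ u ⬝ᵥ (Q.map (Int.cast : ℤ → ℝ) *ᵥ u)) {T : ℕ} (hT : ∀ i k, (Q i k).natAbs ≤ T) :
    ∃ (m : ℕ) (R : Matrix (Fin m) (Fin n) ℤ) (σ : ℕ), σ ≠ 0 ∧ ((σ : ℤ) ^ 2) • Q = Rᵀ * R ∧ m ≤ 4 * n ∧
      σ ≤ ((n.factorial * (max T 1) ^ n) ^ 2) ^ n ∧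
      ∀ i k, (R i k).natAbs ≤ ((n.factorial * (max T 1) ^ n) ^ 2) ^ n * (n.factorial * (max T 1) ^ n) := by
  classical
  set A : Matrix (Fin n) (Fin n) ℝ := Q.map (Int.cast : ℤ → ℝ) with hAdef
  have hA : Aᵀ = A := by rw [hAdef, ← transpose_map, hQ]
  obtain ⟨L, hnd, hg, hmax⟩ := exists_maximal_good A
  have hAeq : A = gram A L := eq_gram hA hpsd hnd hg hmax
  set r := L.length with hr
  have hrn : r ≤ n := by have := hnd.length_le_card; rwa [Fintype.card_fin] at this
  set H : ℕ := n.factorial * (max T 1) ^ n with hH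
  -- stage data
  have hst := fun k : Fin r => stage_spec hnd hg k
  set N : Fin r → ℤ := fun k => pminor Q (sfx L k) * bord Q (sfx L k) (piv L k) (piv L k) with hN
  have hNcast : ∀ k, ((N k : ℤ) : ℝ) = pminor A (sfx L k) * bord A (sfx L k) (piv L k) (piv L k) := fun k => by
    rw [hN]; push_cast; rw [cast_pminor, cast_bord]
  have hNpos : ∀ k, 0 < N k := fun k => by
    have h := pminor_mul_bord_pos hA hpsd (hst k).1 (hst k).2.2
    rw [← hNcast] at h
    exact_mod_cast h
  have hNle : ∀ k, (N k).natAbs ≤ H * H := fun k => by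
    rw [hN]
    dsimp only
    rw [Int.natAbs_mul]
    have hlen : (sfx L k).length + 1 ≤ n := (length_sfx_lt L k).trans_le hrn
    exact Nat.mul_le_mul (natAbs_det_submatrix_le Q hT (by omega) _ _) (natAbs_det_submatrix_le Q hT hlen _ _)
  set Nn : Fin r → ℕ := fun k => (N k).toNat with hNn
  have hNnN : ∀ k, ((Nn k : ℕ) : ℤ) = N k := fun k => Int.toNat_of_nonneg (hNpos k).le
  have hNnpos : ∀ k, 0 < Nn k := fun k => by
    have := hNpos k
    show 0 < (N k).toNat
    omega
  have hNnle : ∀ k, Nn k ≤ H * H := fun k => by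
    have := hNle k; rw [← hNnN k, Int.natAbs_natCast] at this; exact this
  set σ : ℕ := ∏ k, Nn k with hσ
  set g : Fin r → ℕ := fun k => ∏ k' ∈ Finset.univ.erase k, Nn k' with hg'
  have hgσ : ∀ k, g k * Nn k = σ := fun k => Finset.prod_erase_mul _ _ (Finset.mem_univ k)
  have hσpos : 0 < σ := Finset.prod_pos fun k _ => hNnpos k
  have hH1 : 1 ≤ H := Nat.mul_pos (Nat.factorial_pos n) (Nat.pow_pos (lt_of_lt_of_le Nat.one_pos (le_max_right _ _)))
  have hσle : σ ≤ (H ^ 2) ^ n := by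
    calc σ ≤ ∏ _k : Fin r, H ^ 2 := Finset.prod_le_prod (fun k _ => (hNnpos k).le) fun k _ => by rw [sq]; exact hNnle k
      _ = (H ^ 2) ^ r := by simp
      _ ≤ (H ^ 2) ^ n := Nat.pow_le_pow_right (by positivity) hrn
  -- four squares
  have h4 : ∀ k, ∃ a : Fin 4 → ℤ, ∑ s, a s * a s = Nn k := fun k => Literature.LinearAlgebra.Matrix.exists_sum_fin_four_sq _
  choose a ha using h4
  -- the certificate
  let R₀ : Matrix (Fin r × Fin 4) (Fin n) ℤ := Matrix.of fun p y => (g p.1 : ℤ) * a p.1 p.2 * bord Q (sfx L p.1) (piv L p.1) y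
  let e : Fin r × Fin 4 ≃ Fin (r * 4) := finProdFinEquiv
  refine ⟨r * 4, Matrix.of fun ρ y => R₀ (e.symm ρ) y, σ, hσpos.ne', ?_, by omega, hσle, ?_⟩
  · -- the Gram identity
    rw [Literature.LinearAlgebra.Matrix.transpose_mul_self_reindex e R₀]
    ext x y
    rw [Literature.LinearAlgebra.Matrix.transpose_mul_self_apply, Matrix.smul_apply, smul_eq_mul, Fintype.sum_prod_type]
    have hrow : ∀ k : Fin r, ∑ s : Fin 4, R₀ (k, s) x * R₀ (k, s) y =
        (g k : ℤ) ^ 2 * Nn k * (bord Q (sfx L k) (piv L k) x * bord Q (sfx L k) (piv L k) y) := fun k => by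
      simp only [R₀, Matrix.of_apply]
      rw [← ha k, Finset.mul_sum, Finset.sum_mul]
      exact Finset.sum_congr rfl fun s _ => by ring
    simp_rw [hrow]
    -- pass to `ℝ`
    have hinj : Function.Injective (Int.cast : ℤ → ℝ) := Int.cast_injective
    apply hinj
    have hQA : ((Q x y : ℤ) : ℝ) = A x y := by rw [hAdef, map_apply]
    push_cast
    rw [hQA, hAeq, gram_apply, Finset.mul_sum]
    refine Finset.sum_congr rfl fun k _ => ?_
    rw [← hNcast k, ← hNnN k, ← cast_bord, ← cast_bord]
    have hk0 : ((Nn k : ℕ) : ℝ) ≠ 0 := by exact_mod_cast (hNnpos k).ne'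
    rw [← hgσ k]
    push_cast
    field_simp
  · -- sizes of the entries
    intro ρ y
    simp only [Matrix.of_apply]
    rcases hks : e.symm ρ with ⟨k, s⟩
    simp only [R₀, Matrix.of_apply]
    rw [Int.natAbs_mul, Int.natAbs_mul, Int.natAbs_natCast]
    have has : (a k s).natAbs ≤ Nn k := by
      have := Literature.LinearAlgebra.Matrix.natAbs_le_of_sum_sq_eq (ha k) s
      exact_mod_cast this
    have hb : (bord Q (sfx L k) (piv L k) y).natAbs ≤ H :=
      natAbs_det_submatrix_le Q hT ((length_sfx_lt L k).trans_le hrn) _ _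
    calc g k * (a k s).natAbs * (bord Q (sfx L k) (piv L k) y).natAbs ≤ g k * Nn k * H :=
          Nat.mul_le_mul (Nat.mul_le_mul_left _ has) hb
      _ = σ * H := by rw [hgσ]
      _ ≤ (H ^ 2) ^ n * H := Nat.mul_le_mul_right _ hσle

end ExactLDL

namespace FarCert

/-- The size polynomial of the exact PSD certificate: `(2X+1)(X² + X(X+1) + 2) + 1`. [folklore] -/
def psdCertPoly : Polynomial ℕ :=
  (2 * Polynomial.X + 1) * (Polynomial.X * Polynomial.X + Polynomial.X * (Polynomial.X + 1) + 2) + 1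

/-- Evaluation of `psdCertPoly`. [folklore] -/
theorem psdCertPoly_eval (N : ℕ) : psdCertPoly.eval N = (2 * N + 1) * (N * N + N * (N + 1) + 2) + 1 := by
  simp [psdCertPoly]

/-- **Discharge of `psd_cert_exists`** (Schrijver 1986, Thm. 3.3 / Cor. 3.3a with Lagrange's four
squares): by `ExactLDL.exists_integer_gram_cert` with `T = 2^S`, `H = n! 2^{Sn}`, all sizes are at most
`(2n+1) size H + 1 ≤ psdCertPoly (n + S)`.
[cite: Schrijver1986, Thm. 3.3 and Cor. 3.3a (each number in Gaussian elimination is a quotient of subdeterminants)] -/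
theorem psd_cert_exists_holds : psd_cert_exists := by
  refine ⟨psdCertPoly, fun n S Q hQ hpsd hS => ?_⟩
  obtain ⟨m, R, σ, hσ, hRR, hm, hσle, hRle⟩ := ExactLDL.exists_integer_gram_cert Q hQ hpsd hS
  have hmax : max (2 ^ S) 1 = 2 ^ S := max_eq_left Nat.one_le_two_pow
  rw [hmax] at hσle hRle
  set H : ℕ := n.factorial * (2 ^ S) ^ n with hH
  -- size of `H`
  have hHs : H.size ≤ (n + S) * (n + S) + (n + S) * (n + S + 1) + 2 := by
    have h0 := size_factorial_mul_pow_le n (2 ^ S)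
    rw [Nat.size_pow] at h0
    have h1 : n * n.size ≤ (n + S) * (n + S) := Nat.mul_le_mul (Nat.le_add_right _ _)
      ((Nat.size_le.2 Nat.lt_two_pow_self).trans (Nat.le_add_right _ _))
    have h2 : n * (S + 1) ≤ (n + S) * (n + S + 1) := Nat.mul_le_mul (Nat.le_add_right _ _) (by omega)
    rw [hH]; omega
  have hpow : ((H ^ 2) ^ n).size ≤ 2 * n * H.size + 1 := by
    rw [← pow_mul]
    have := size_pow_le H (2 * n)
    linarith
  refine ⟨m, R, σ, hσ, hRR, hm, ?_, fun i k => ?_⟩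
  · rw [psdCertPoly_eval]
    have h1 : σ.size ≤ 2 * n * H.size + 1 := (Nat.size_le_size hσle).trans hpow
    have h2 : 2 * n * H.size ≤ (2 * (n + S) + 1) * ((n + S) * (n + S) + (n + S) * (n + S + 1) + 2) :=
      Nat.mul_le_mul (by omega) hHs
    omega
  · rw [psdCertPoly_eval]
    have h1 : (R i k).natAbs.size ≤ (2 * n * H.size + 1) + H.size :=
      (Nat.size_le_size (hRle i k)).trans ((size_mul_le _ _).trans (Nat.add_le_add_right hpow _))
    have h2 : (2 * n + 1) * H.size ≤ (2 * (n + S) + 1) * ((n + S) * (n + S) + (n + S) * (n + S + 1) + 2) :=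
      Nat.mul_le_mul (by omega) hHs
    have h3 : (2 * n * H.size + 1) + H.size = (2 * n + 1) * H.size + 1 := by ring
    omega

end FarCert

end Literature.Algebra.EuclideanLattices

end
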